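import Summits.QuantumAdvantage.QuantumAdvantage.Theorems.RankDialF2
import HarnessLib

/-!
# RankDial (F3) — §12 two disjoint collisions fill a fibre (`le_of_minMass_eq_zero`), the `d = 1` threshold `massZero_threshold_d1`, the mixed block, `massZero_sandwich`, `olson_dial`

TARGET BY NAME (cell decomp-qadv, RESIDUAL MODE): item stmt-QuantumAdvantage-23109
`Summit.QuantumAdvantage.QuantumAdvantage.Theses.OddPrimeWalk.ManyReadersSqrtOdd`, through rung R5 = `AdviceFreeQNC0.WalkHardFLinSel p`.
This file SUPPORTS the item (`--supports`); it does not close it.  Declaration bodies are byte-identical to the cell node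
«OlsonDial» (decomp-qadv lens-1 «grading / quantitative ladder», generation 26; node file sha256 6d975657…), cut into
≤ 400-line parts E1 (§7–§8) → E2 (§9–§10) → F1 (§11, §11bis) → F2 (§11ter) → F3 (§12); see part E1 for the whole node.
-/

set_option linter.dupNamespace false
set_option autoImplicit false

noncomputable section
open Classical

namespace Summit.QuantumAdvantage.QuantumAdvantage.Theorems.RankDial

open Finset
open Summit.QuantumAdvantage.AdviceFreeQNC0
open Literature.Computability.MetaComplexity Literature.Computability.MetaComplexity.Smolensky

/-! ### §12 Two disjoint collisions fill a fibre: `M(Φ) > 0` once `ℓ ≥ 2((p−1)d + 1)`; the `d = 1` threshold DECIDED -/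

section TwoCollisions
variable {p : ℕ}

/-- left half of a sketch on `ℓ₁ + ℓ₂` columns -/
def leftPhi {d ℓ₁ ℓ₂ : ℕ} (Φ : Fin d → Fin (ℓ₁ + ℓ₂) → ZMod p) : Fin d → Fin ℓ₁ → ZMod p :=
  fun k j => Φ k (Fin.castAdd ℓ₂ j)

/-- right half of a sketch on `ℓ₁ + ℓ₂` columns -/
def rightPhi {d ℓ₁ ℓ₂ : ℕ} (Φ : Fin d → Fin (ℓ₁ + ℓ₂) → ZMod p) : Fin d → Fin ℓ₂ → ZMod p :=
  fun k j => Φ k (Fin.natAdd ℓ₁ j)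

/-- the weight of a glued vector -/
theorem wt_append {ℓ₁ ℓ₂ : ℕ} (u : Fin ℓ₁ → Bool) (w : Fin ℓ₂ → Bool) : wt (Fin.append u w) = wt u + wt w := by
  unfold wt
  rw [Finset.card_filter, Finset.card_filter, Finset.card_filter, Fin.sum_univ_add]
  simp only [Fin.append_left, Fin.append_right]

/-- the sketch of a glued vector -/
theorem skt_append {d ℓ₁ ℓ₂ : ℕ} (Φ : Fin d → Fin (ℓ₁ + ℓ₂) → ZMod p) (u : Fin ℓ₁ → Bool) (w : Fin ℓ₂ → Bool) :
    skt Φ (Fin.append u w) = skt (leftPhi Φ) u + skt (rightPhi Φ) w := by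
  funext k
  show (∑ j, if Fin.append u w j then Φ k j else 0) =
    (∑ j, if u j then Φ k (Fin.castAdd ℓ₂ j) else 0) + ∑ j, if w j then Φ k (Fin.natAdd ℓ₁ j) else 0
  rw [Fin.sum_univ_add]
  simp only [Fin.append_left, Fin.append_right]

/-- a vector lies in its own class of its own fibre -/
theorem classCount_pos {d ℓ : ℕ} (Φ : Fin d → Fin ℓ → ZMod p) (x : Fin d → ZMod p) (v : Fin ℓ → Bool)
    (hv : skt Φ v = x) (r : ℕ) (hr : wt v % 3 = r) : 0 < classCount Φ x r := by
  unfold classCount fib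
  refine Finset.card_pos.2 ⟨v, ?_⟩
  rw [Finset.mem_filter, Finset.mem_filter]
  exact ⟨⟨Finset.mem_univ v, hv⟩, hr⟩

/-- **Two disjoint collisions fill a fibre.**  If both halves are longer than `(p−1)d` (`p ≠ 3` prime), some fibre of
`Φ` contains all three weight classes, so `M(Φ) > 0`: glue the collisions `(u₁,w₁)`, `(u₂,w₂)` of the two halves
(`exists_collision`); the four vectors `uᵢ ++ uⱼ` share one sketch value and their weights `A + B`, `A' + B`, `A + B'`,
`A' + B'` with `A ≢ A'`, `B ≢ B' (mod 3)` cover `ℤ/3`. -/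
theorem minMass_pos_append (p : ℕ) [Fact p.Prime] (hp3 : p ≠ 3) {d ℓ₁ ℓ₂ : ℕ} (h₁ : (p - 1) * d < ℓ₁)
    (h₂ : (p - 1) * d < ℓ₂) (Φ : Fin d → Fin (ℓ₁ + ℓ₂) → ZMod p) : 0 < minMass Φ := by
  obtain ⟨u₁, w₁, hs₁, hw₁⟩ := exists_collision p hp3 h₁ (leftPhi Φ)
  obtain ⟨u₂, w₂, hs₂, hw₂⟩ := exists_collision p hp3 h₂ (rightPhi Φ)
  have hx : ∀ (a : Fin ℓ₁ → Bool) (b : Fin ℓ₂ → Bool), (a = u₁ ∨ a = w₁) → (b = u₂ ∨ b = w₂) →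
      skt Φ (Fin.append a b) = skt Φ (Fin.append u₁ u₂) := by
    intro a b ha hb
    rw [skt_append, skt_append]
    rcases ha with rfl | rfl <;> rcases hb with rfl | rfl
    · rfl
    · rw [hs₂]
    · rw [hs₁]
    · rw [hs₁, hs₂]
  have hcover : ∀ r, r < 3 → 0 < classCount Φ (skt Φ (Fin.append u₁ u₂)) r := by
    intro r hr
    have hcase : (wt u₁ + wt u₂) % 3 = r ∨ (wt w₁ + wt u₂) % 3 = r ∨ (wt u₁ + wt w₂) % 3 = r ∨
        (wt w₁ + wt w₂) % 3 = r := by omega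
    rcases hcase with h | h | h | h
    · exact classCount_pos Φ _ (Fin.append u₁ u₂) (hx _ _ (Or.inl rfl) (Or.inl rfl)) r (by rw [wt_append]; exact h)
    · exact classCount_pos Φ _ (Fin.append w₁ u₂) (hx _ _ (Or.inr rfl) (Or.inl rfl)) r (by rw [wt_append]; exact h)
    · exact classCount_pos Φ _ (Fin.append u₁ w₂) (hx _ _ (Or.inl rfl) (Or.inr rfl)) r (by rw [wt_append]; exact h)
    · exact classCount_pos Φ _ (Fin.append w₁ w₂) (hx _ _ (Or.inr rfl) (Or.inr rfl)) r (by rw [wt_append]; exact h)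
  have hmin : 0 < minClass Φ (skt Φ (Fin.append u₁ u₂)) := by
    have h0 := hcover 0 (by norm_num)
    have h1 := hcover 1 (by norm_num)
    have h2 := hcover 2 (by norm_num)
    unfold minClass
    omega
  unfold minMass
  exact lt_of_lt_of_le hmin (Finset.single_le_sum (f := minClass Φ) (fun _ _ => Nat.zero_le _)
    (Finset.mem_image_of_mem _ (Finset.mem_univ _)))

/-- **PROVED weak `ε = 0` law**: a sketch of min-mass zero has `ℓ ≤ 2(p−1)d + 1` (`p ≠ 3` prime). -/
theorem le_of_minMass_eq_zero (p : ℕ) [Fact p.Prime] (hp3 : p ≠ 3) {d ℓ : ℕ} (Φ : Fin d → Fin ℓ → ZMod p)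
    (hM : minMass Φ = 0) : ℓ ≤ 2 * ((p - 1) * d) + 1 := by
  by_contra h
  obtain ⟨ℓ₂, rfl⟩ : ∃ ℓ₂, ℓ = ((p - 1) * d + 1) + ℓ₂ := ⟨ℓ - ((p - 1) * d + 1), by omega⟩
  have hpos := minMass_pos_append p hp3 (by omega) (by omega) Φ
  omega

/-- **The `d = 1` threshold of the `ε = 0` law DECIDED: exactly `2p − 1`** (`p ≠ 3` prime) — `M = 0 ⟹ ℓ ≤ 2p − 1`, and
the fat block on `2p − 1` bits has `M = 0`.  (So `MassZeroBound p` holds at `d = 1` and cannot be improved there.) -/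
theorem massZero_threshold_d1 (p : ℕ) [Fact p.Prime] (hp3 : p ≠ 3) :
    (∀ (ℓ : ℕ) (Φ : Fin 1 → Fin ℓ → ZMod p), minMass Φ = 0 → ℓ ≤ 2 * p - 1) ∧
      minMass (fun (_ : Fin 1) (_ : Fin (2 * p - 1)) => (1 : ZMod p)) = 0 := by
  refine ⟨fun ℓ Φ hM => ?_, minMass_fatBlock_eq_zero p hp3⟩
  have hp2 : 2 ≤ p := (Fact.out : p.Prime).two_le
  have h := le_of_minMass_eq_zero p hp3 Φ hM
  omega

/-- `MassZeroBound p` restricted to `d = 1` HOLDS. -/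
theorem massZeroBound_d1 (p : ℕ) [Fact p.Prime] (hp3 : p ≠ 3) (ℓ : ℕ) (Φ : Fin 1 → Fin ℓ → ZMod p)
    (hM : minMass Φ = 0) : ℓ ≤ (p - 1) * 1 + p := by
  have hp2 : 2 ≤ p := (Fact.out : p.Prime).two_le
  have h := (massZero_threshold_d1 p hp3).1 ℓ Φ hM
  omega

/-- splitting a sketch value over `Fin (a + b)` into the two halves -/
theorem skt_split {d a b : ℕ} (Φ : Fin d → Fin (a + b) → ZMod p) (v : Fin (a + b) → Bool) (k : Fin d) :
    skt Φ v k = (∑ j₁ : Fin a, if v (Fin.castAdd b j₁) then Φ k (Fin.castAdd b j₁) else 0) +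
      ∑ j₂ : Fin b, if v (Fin.natAdd a j₂) then Φ k (Fin.natAdd a j₂) else 0 :=
  Fin.sum_univ_add _

/-- splitting the weight over `Fin (a + b)` -/
theorem wt_split {a b : ℕ} (v : Fin (a + b) → Bool) :
    wt v = wt (fun j₁ => v (Fin.castAdd b j₁)) + wt (fun j₂ => v (Fin.natAdd a j₂)) := by
  unfold wt
  rw [Finset.card_filter, Finset.card_filter, Finset.card_filter, Fin.sum_univ_add]

/-- **The mixed block sketch**: `m` thin blocks of size `p − 1` (rows `0 … m−1` count them) followed by ONE fat block
of size `2p − 1` (row `m` counts it): `d = m + 1` rows, `ℓ = (p−1)d + p` columns. -/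
def mixPhi (p m : ℕ) (k : Fin (m + 1)) : Fin (m * (p - 1) + (2 * p - 1)) → ZMod p :=
  if hk : (k : ℕ) < m then Fin.append (blockPhi p m (p - 1) ⟨k, hk⟩) (fun _ => 0)
  else Fin.append (fun _ => 0) (fun _ => 1)

/-- thin row, thin column -/
theorem mixPhi_thin_left (p m : ℕ) (k : Fin m) (j₁ : Fin (m * (p - 1))) :
    mixPhi p m (Fin.castSucc k) (Fin.castAdd (2 * p - 1) j₁) = blockPhi p m (p - 1) k j₁ := by
  unfold mixPhi
  rw [dif_pos (by simp), Fin.append_left]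
  rfl

/-- thin row, fat column -/
theorem mixPhi_thin_right (p m : ℕ) (k : Fin m) (j₂ : Fin (2 * p - 1)) :
    mixPhi p m (Fin.castSucc k) (Fin.natAdd (m * (p - 1)) j₂) = 0 := by
  unfold mixPhi
  rw [dif_pos (by simp), Fin.append_right]

/-- fat row, thin column -/
theorem mixPhi_last_left (p m : ℕ) (j₁ : Fin (m * (p - 1))) :
    mixPhi p m (Fin.last m) (Fin.castAdd (2 * p - 1) j₁) = 0 := by
  unfold mixPhi
  rw [dif_neg (by simp), Fin.append_left]

/-- fat row, fat column -/
theorem mixPhi_last_right (p m : ℕ) (j₂ : Fin (2 * p - 1)) :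
    mixPhi p m (Fin.last m) (Fin.natAdd (m * (p - 1)) j₂) = 1 := by
  unfold mixPhi
  rw [dif_neg (by simp), Fin.append_right]

/-- **The mixed block sketch has min-mass ZERO** (`p ≠ 3` prime): on a fibre the thin part of the weight is determined
and the fat part takes two values `c`, `c + p`, so one class is missed.  Hence `MassZeroBound p`, if true, is TIGHT
for every `d ≥ 1`: the `ε = 0` threshold `Z(p,d)` satisfies `(p−1)d + p ≤ Z(p,d) ≤ 2(p−1)d + 1`. -/
theorem minMass_mixBlock_eq_zero (p : ℕ) [Fact p.Prime] (hp3 : p ≠ 3) (m : ℕ) : minMass (mixPhi p m) = 0 := by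
  have hp : p.Prime := Fact.out
  have hp2 : 2 ≤ p := hp.two_le
  haveI : NeZero p := ⟨hp.ne_zero⟩
  have hp3' : p % 3 ≠ 0 := fun h =>
    hp3 ((Nat.prime_dvd_prime_iff_eq Nat.prime_three hp).1 (Nat.dvd_of_mod_eq_zero h)).symm
  have ht : p - 1 < p := by omega
  -- thin coordinates = block counts of the thin part; fat coordinate = weight of the fat part
  have hthin : ∀ (v : Fin (m * (p - 1) + (2 * p - 1)) → Bool) (k : Fin m),
      skt (mixPhi p m) v (Fin.castSucc k) =
        skt (blockPhi p m (p - 1)) (fun j₁ => v (Fin.castAdd (2 * p - 1) j₁)) k := by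
    intro v k
    rw [skt_split]
    simp only [mixPhi_thin_left, mixPhi_thin_right, ite_self, Finset.sum_const_zero, add_zero]
    rfl
  have hlast : ∀ v : Fin (m * (p - 1) + (2 * p - 1)) → Bool,
      skt (mixPhi p m) v (Fin.last m) = (wt (fun j₂ => v (Fin.natAdd (m * (p - 1)) j₂)) : ZMod p) := by
    intro v
    rw [skt_split]
    simp only [mixPhi_last_left, mixPhi_last_right, ite_self, Finset.sum_const_zero, zero_add]
    rw [Finset.sum_boole]
    rfl
  have hW : ∀ v : Fin (m * (p - 1) + (2 * p - 1)) → Bool,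
      wt (fun j₁ => v (Fin.castAdd (2 * p - 1) j₁)) = ∑ k : Fin m, (skt (mixPhi p m) v (Fin.castSucc k)).val := by
    intro v
    rw [← block_wt ht (fun j₁ => v (Fin.castAdd (2 * p - 1) j₁))]
    refine Finset.sum_congr rfl fun k _ => ?_
    rw [hthin v k]
    rfl
  have hle : ∀ w : Fin (2 * p - 1) → Bool, wt w ≤ 2 * p - 1 := by
    intro w
    unfold wt
    exact (Finset.card_filter_le _ _).trans (by simp)
  unfold minMass
  refine Finset.sum_eq_zero fun x hx => ?_
  obtain ⟨v₀, _, rfl⟩ := Finset.mem_image.1 hx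
  -- `W` = thin weight, `c` = fat weight mod p, both constant on the fibre
  set W := wt (fun j₁ => v₀ (Fin.castAdd (2 * p - 1) j₁)) with hWdef
  set c := wt (fun j₂ => v₀ (Fin.natAdd (m * (p - 1)) j₂)) % p with hcdef
  have hfib : ∀ v : Fin (m * (p - 1) + (2 * p - 1)) → Bool, skt (mixPhi p m) v = skt (mixPhi p m) v₀ →
      wt v % 3 ≠ (W + c + 2 * p) % 3 := by
    intro v hv
    have h1 : wt (fun j₁ => v (Fin.castAdd (2 * p - 1) j₁)) = W := by
      rw [hWdef, hW v, hW v₀, hv]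
    have h2 : wt (fun j₂ => v (Fin.natAdd (m * (p - 1)) j₂)) % p = c := by
      have h := congrFun hv (Fin.last m)
      rw [hlast, hlast] at h
      have h' := congrArg ZMod.val h
      rwa [ZMod.val_natCast, ZMod.val_natCast] at h'
    have hq : wt (fun j₂ => v (Fin.natAdd (m * (p - 1)) j₂)) / p ≤ 1 := by
      have := Nat.div_le_div_right (c := p) (hle fun j₂ => v (Fin.natAdd (m * (p - 1)) j₂))
      have h3 : (2 * p - 1) / p = 1 := by
        rw [Nat.div_eq_of_lt_le] <;> omega
      omega
    have hdecomp := Nat.div_add_mod (wt fun j₂ => v (Fin.natAdd (m * (p - 1)) j₂)) p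
    have hc : c < p := by rw [hcdef]; exact Nat.mod_lt _ hp.pos
    rw [wt_split v, h1]
    rcases Nat.le_one_iff_eq_zero_or_eq_one.1 hq with hq0 | hq1
    · rw [hq0, mul_zero, zero_add] at hdecomp
      omega
    · rw [hq1, mul_one] at hdecomp
      omega
  have hr : (W + c + 2 * p) % 3 < 3 := Nat.mod_lt _ (by norm_num)
  have h0 : classCount (mixPhi p m) (skt (mixPhi p m) v₀) ((W + c + 2 * p) % 3) = 0 := by
    unfold classCount fib
    refine Finset.card_eq_zero.2 (Finset.filter_eq_empty_iff.2 fun v hv h => ?_)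
    rw [Finset.mem_filter] at hv
    exact hfib v hv.2 h
  have := minClass_le (mixPhi p m) (skt (mixPhi p m) v₀) _ hr
  omega

/-- **The `ε = 0` threshold is sandwiched for every `d ≥ 1`**: there is a `d`-row sketch on `(p−1)d + p` bits with
`M = 0`, and none on more than `2(p−1)d + 1` bits. -/
theorem massZero_sandwich (p : ℕ) [Fact p.Prime] (hp3 : p ≠ 3) (m : ℕ) :
    (∃ Φ : Fin (m + 1) → Fin (m * (p - 1) + (2 * p - 1)) → ZMod p, minMass Φ = 0) ∧
      ∀ (ℓ : ℕ) (Φ : Fin (m + 1) → Fin ℓ → ZMod p), minMass Φ = 0 → ℓ ≤ 2 * ((p - 1) * (m + 1)) + 1 :=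
  ⟨⟨mixPhi p m, minMass_mixBlock_eq_zero p hp3 m⟩, fun _ Φ hM => le_of_minMass_eq_zero p hp3 Φ hM⟩

/-- **THE ALGEBRAIC + QUANTITATIVE DIAL at a prime `p ≥ 5`, one conjunction** (all kernel-checked):
exact reading of `|v| mod 3` needs `ℓ ≤ (p−1)d` (tight); one pure class needs `ℓ ≤ (p−1)d + 1`; min-mass zero needs
`ℓ ≤ 2(p−1)d + 1` (`= 2p − 1` tight at `d = 1`); the min-mass LAW holds at rank `ℓ/E` and fails at rank `ℓ/(p−1)`. -/
theorem olson_dial (p : ℕ) [Fact p.Prime] (hp : 5 ≤ p) :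
    ExactRankBound p ∧ PureClassBound p ∧
      (∀ (ℓ d : ℕ) (Φ : Fin d → Fin ℓ → ZMod p), minMass Φ = 0 → ℓ ≤ 2 * ((p - 1) * d) + 1) ∧
      MassRankLin p ∧ ¬ MassRank p (fun ℓ => ℓ / (p - 1)) := by
  have hp3 : p ≠ 3 := by omega
  exact ⟨exactRankBound_holds p hp3, pureClassBound_holds p hp3, fun _ _ Φ hM => le_of_minMass_eq_zero p hp3 Φ hM,
    mass_dial_sandwich p hp⟩

end TwoCollisions

end Summit.QuantumAdvantage.QuantumAdvantage.Theorems.RankDial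

end
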